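import Literature.Probability.Percolation.ColourSwitching
import HarnessLib

/-!
# Decoupling along a stopping set: events above the explored region, summed over the explored data

Topic `Literature/Probability/Percolation`; family `crit-perc`, statement **crit-perc.S16**
(`Literature.Probability.Percolation.triTheta_exponent`). The probabilistic step of Kesten's
conditioning on the lowest crossings, in the form used in P. Nolin's proof of the separation lemma
(EJP 13 (2008), §4.4, proof of Lemma 15 [arXiv 0711.4948: Lemma 14]):

> "The event `E_u := {t ≥ u and c_v = c̃_v, σ_v = σ̃_v for any v ∈ {1, …, u}}` is independent
> from the status of the sites above `c̃_u`. Hence, if we condition on `E_u`, percolation there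
> remains unbiased and we can use the RSW theorem. […] Summing over all possibilities for `c̃_i`,
> `σ̃_i` (`1 ≤ i ≤ u`), we get that for some `C'''₄`,
> `P(t ≥ u and c_u is not protected from above) ≤ (1-δ'')^{-C'''₄ log η}`."

Abstractly: let `N` be a **stopping set** (`IsStoppingSet N`, `ColourSwitching.lean`) with values
in a finite set `G` of sites, and let `A_{F,η}` be a family of events indexed by the possible
*explored data* — the value `F` of `N` and the configuration `η = ω ∩ F` on it — such that each
`A_{F,η}` is determined by finitely many sites *off* `F` and has probability at most `ε`. Then the
event "`A` holds for the actual data", `{ω | ω ∈ A_{N(ω), ω ∩ N(ω)}}`, has probability at most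
`ε` (`real_mem_dataEvent_le`): the configuration space is partitioned according to the data, each
piece `{N = F, ω ∩ F = η}` is determined by the sites of `F` (stopping property), hence independent
of `A_{F,η}` (`sitePercolation_real_inter_of_disjoint`), and the pieces have total mass at most `1`.

## References

* P. Nolin, Near-critical percolation in two dimensions, *Electron. J. Probab.* 13 (2008), §4.4,
  proof of Lemma 15 [arXiv 0711.4948: Lemma 14] [Nolin2008].
* H. Kesten, Scaling relations for 2D-percolation, *Comm. Math. Phys.* 109 (1987), proof of
  Lemma 2 [KestenScalingCMP1987].
* B. Bollobás, O. Riordan, *Percolation*, CUP (2006), Ch. 7, proof of Lemma 6, p. 175 (stopping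
  sets) [BollobasRiordan2006].

## Mathlib / tree

Tree: `IsStoppingSet` (`ColourSwitching.lean`), `DeterminedBy`, `determinedBy_iff`,
`DeterminedBy.measurableSet_of_finset` (`PercolationEvents.lean`),
`sitePercolation_real_inter_of_disjoint` (`SitePercolationMeasure.lean`). Mathlib:
`MeasureTheory.measureReal_biUnion_finset_le`, `MeasureTheory.measureReal_biUnion_finset`,
`Finset.PairwiseDisjoint`.
-/

noncomputable section

open MeasureTheory Set

namespace Literature.Probability.Percolation

variable {V : Type*}

/-! ### The pieces of the data partition -/

/-- **The piece of configuration space with explored data `(F, η)`**: the stopping set takes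
the value `F` and the configuration on `F` is `η`. [cite: Nolin2008, §4.4, proof of Lemma 15 (the events E_u; arXiv 0711.4948: Lemma 14)] -/
def dataPiece (N : Set V → Finset V) (F η : Finset V) : Set (SiteConfig V) :=
  {ω | N ω = F ∧ ∀ v ∈ F, v ∈ ω ↔ v ∈ η}

/-- Under the stopping property, **each piece is determined by the sites of its own `F`** ("the
event that `P'` takes a particular value is independent of the states of the sites of
`G ∖ N(P')`"). [cite: BollobasRiordan2006, Ch. 7 proof of Lemma 6 p. 175] -/
theorem determinedBy_dataPiece {N : Set V → Finset V} (hN : IsStoppingSet N) (F η : Finset V) :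
    DeterminedBy (dataPiece N F η) ↑F := by
  rw [determinedBy_iff]
  have key : ∀ ω ω' : Set V, ω ∩ ↑F = ω' ∩ ↑F → ω ∈ dataPiece N F η → ω' ∈ dataPiece N F η := by
    rintro ω ω' h ⟨hNF, hη⟩
    have hag : ∀ v ∈ F, v ∈ ω ↔ v ∈ ω' := fun v hv => by
      have := congrArg (fun S : Set V => v ∈ S) h
      simpa [hv] using this
    refine ⟨?_, fun v hv => (hag v hv).symm.trans (hη v hv)⟩
    rw [← hNF]
    exact hN ω ω' fun v hv => hag v (by rw [← hNF]; exact hv)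
  exact fun ω ω' h => ⟨key ω ω' h, key ω' ω h.symm⟩

/-- Distinct data give disjoint pieces. [folklore] -/
theorem disjoint_dataPiece {N : Set V → Finset V} {F η F' η' : Finset V} (hη : η ⊆ F) (hη' : η' ⊆ F')
    (h : (F, η) ≠ (F', η')) : Disjoint (dataPiece N F η) (dataPiece N F' η') := by
  rw [Set.disjoint_left]
  rintro ω ⟨hF, h1⟩ ⟨hF', h2⟩
  apply h
  have hFF : F = F' := hF.symm.trans hF'
  subst hFF
  simp only [Prod.mk.injEq, true_and]
  ext v
  constructor
  · intro hv; exact (h2 v (hη hv)).1 ((h1 v (hη hv)).2 hv)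
  · intro hv; exact (h1 v (hη' hv)).1 ((h2 v (hη' hv)).2 hv)

/-- Every configuration lies in the piece of its own data `(N ω, the sites of N ω open in ω)`. [folklore] -/
theorem mem_dataPiece_self (N : Set V → Finset V) (ω : Set V) [DecidablePred (· ∈ ω)] :
    ω ∈ dataPiece N (N ω) ((N ω).filter (· ∈ ω)) :=
  ⟨rfl, fun v hv => by simp [Finset.mem_filter, hv]⟩

/-! ### The decoupling inequality -/

open Classical in
/-- **Decoupling along a stopping set.** Let `N` be a stopping set with `N(ω) ⊆ G`, and for all
data `(F, η)` let `A F η` be an event determined by a finite set of sites disjoint from `F`, of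
`P_p`-probability at most `ε ≥ 0`. Then `P_p({ω | ω ∈ A (N ω) (sites of N ω open in ω)}) ≤ ε`
(Nolin: conditionally on `E_u`, "percolation there remains unbiased"; "Summing over all
possibilities …"). [cite: Nolin2008, §4.4, proof of Lemma 15 (arXiv 0711.4948: Lemma 14)] [cite: KestenScalingCMP1987, proof of Lemma 2] -/
theorem real_mem_dataEvent_le (p : unitInterval) {G : Finset V} {N : Set V → Finset V}
    (hN : IsStoppingSet N) (hNG : ∀ ω, N ω ⊆ G) (A : Finset V → Finset V → Set (SiteConfig V))
    (hA : ∀ F η, ∃ H : Finset V, Disjoint F H ∧ DeterminedBy (A F η) ↑H) {ε : ℝ} (hε : 0 ≤ ε)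
    (hAε : ∀ F η, (sitePercolation V p).real (A F η) ≤ ε) :
    (sitePercolation V p).real {ω | ω ∈ A (N ω) ((N ω).filter (· ∈ ω))} ≤ ε := by
  set μ := sitePercolation V p with hμ
  -- the index set of data: pairs of subsets of `G` with `η ⊆ F`
  set I : Finset (Finset V × Finset V) := (G.powerset ×ˢ G.powerset).filter fun d => d.2 ⊆ d.1 with hI
  have hcover : {ω : Set V | ω ∈ A (N ω) ((N ω).filter (· ∈ ω))} ⊆
      ⋃ d ∈ I, dataPiece N d.1 d.2 ∩ A d.1 d.2 := by
    intro ω hω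
    have hd : (N ω, (N ω).filter (· ∈ ω)) ∈ I := by
      rw [hI, Finset.mem_filter, Finset.mem_product, Finset.mem_powerset, Finset.mem_powerset]
      exact ⟨⟨hNG ω, (Finset.filter_subset _ _).trans (hNG ω)⟩, Finset.filter_subset _ _⟩
    refine Set.mem_biUnion hd ⟨⟨rfl, fun v hv => by simp [Finset.mem_filter, hv]⟩, hω⟩
  -- the pieces are disjoint, measurable, of total mass at most one
  have hdisj : (↑I : Set (Finset V × Finset V)).PairwiseDisjoint fun d => dataPiece N d.1 d.2 := by
    intro d hd d' hd' hne
    have h1 : d.2 ⊆ d.1 := (Finset.mem_filter.1 (Finset.mem_coe.1 hd)).2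
    have h2 : d'.2 ⊆ d'.1 := (Finset.mem_filter.1 (Finset.mem_coe.1 hd')).2
    exact disjoint_dataPiece h1 h2 (by rwa [Prod.mk.eta, Prod.mk.eta])
  have hmeas : ∀ d ∈ I, MeasurableSet (dataPiece N d.1 d.2) := fun d _ =>
    (determinedBy_dataPiece hN d.1 d.2).measurableSet_of_finset
  have htotal : ∑ d ∈ I, μ.real (dataPiece N d.1 d.2) ≤ 1 := by
    rw [← measureReal_biUnion_finset hdisj hmeas]
    exact (measureReal_mono (subset_univ _) (measure_ne_top _ _)).trans (by rw [probReal_univ])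
  -- independence piece by piece
  have hind : ∀ d ∈ I, μ.real (dataPiece N d.1 d.2 ∩ A d.1 d.2) ≤ μ.real (dataPiece N d.1 d.2) * ε := by
    intro d _
    obtain ⟨H, hFH, hAH⟩ := hA d.1 d.2
    rw [hμ, sitePercolation_real_inter_of_disjoint p (determinedBy_dataPiece hN d.1 d.2) hAH hFH]
    exact mul_le_mul_of_nonneg_left (hAε d.1 d.2) measureReal_nonneg
  calc μ.real {ω : Set V | ω ∈ A (N ω) ((N ω).filter (· ∈ ω))}
      ≤ μ.real (⋃ d ∈ I, dataPiece N d.1 d.2 ∩ A d.1 d.2) := measureReal_mono hcover (measure_ne_top _ _)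
    _ ≤ ∑ d ∈ I, μ.real (dataPiece N d.1 d.2 ∩ A d.1 d.2) := measureReal_biUnion_finset_le _ _
    _ ≤ ∑ d ∈ I, μ.real (dataPiece N d.1 d.2) * ε := Finset.sum_le_sum hind
    _ = (∑ d ∈ I, μ.real (dataPiece N d.1 d.2)) * ε := (Finset.sum_mul _ _ _).symm
    _ ≤ 1 * ε := mul_le_mul_of_nonneg_right htotal hε
    _ = ε := one_mul ε

/-! ### The lower decoupling inequality (locally monotone events given the data) -/

open Classical in
/-- **Equality form of the decoupling**: for a stopping set `N ⊆ G` and data-indexed events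
`A F η` determined by finite sets disjoint from `F`,
`P_p({ω | ω ∈ A (N ω) (open sites of N ω)}) = Σ_{(F,η)} P_p(data = (F, η)) · P_p(A F η)`. [cite: Nolin2008, §4.4, proof of Lemma 15 ("Summing over all possibilities"; arXiv 0711.4948: Lemma 14)] -/
theorem real_mem_dataEvent_eq (p : unitInterval) {G : Finset V} {N : Set V → Finset V}
    (hN : IsStoppingSet N) (hNG : ∀ ω, N ω ⊆ G) (A : Finset V → Finset V → Set (SiteConfig V))
    (hA : ∀ F η, ∃ H : Finset V, Disjoint F H ∧ DeterminedBy (A F η) ↑H) :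
    (sitePercolation V p).real {ω | ω ∈ A (N ω) ((N ω).filter (· ∈ ω))} =
      ∑ d ∈ (G.powerset ×ˢ G.powerset).filter (fun d => d.2 ⊆ d.1),
        (sitePercolation V p).real (dataPiece N d.1 d.2) * (sitePercolation V p).real (A d.1 d.2) := by
  set μ := sitePercolation V p with hμ
  set I : Finset (Finset V × Finset V) := (G.powerset ×ˢ G.powerset).filter fun d => d.2 ⊆ d.1 with hI
  have hcover : {ω : Set V | ω ∈ A (N ω) ((N ω).filter (· ∈ ω))} = ⋃ d ∈ I, dataPiece N d.1 d.2 ∩ A d.1 d.2 := by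
    ext ω
    constructor
    · intro hω
      have hd : (N ω, (N ω).filter (· ∈ ω)) ∈ I := by
        rw [hI, Finset.mem_filter, Finset.mem_product, Finset.mem_powerset, Finset.mem_powerset]
        exact ⟨⟨hNG ω, (Finset.filter_subset _ _).trans (hNG ω)⟩, Finset.filter_subset _ _⟩
      exact Set.mem_biUnion hd ⟨⟨rfl, fun v hv => by simp [Finset.mem_filter, hv]⟩, hω⟩
    · intro hω
      obtain ⟨d, hd, ⟨hNd, hη⟩, hA'⟩ := Set.mem_iUnion₂.1 hω
      have h1 : N ω = d.1 := hNd
      have h2 : (N ω).filter (· ∈ ω) = d.2 := by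
        have hsub : d.2 ⊆ d.1 := (Finset.mem_filter.1 hd).2
        ext v
        rw [Finset.mem_filter, h1]
        constructor
        · rintro ⟨hv, hvω⟩; exact (hη v hv).1 hvω
        · intro hv; exact ⟨hsub hv, (hη v (hsub hv)).2 hv⟩
      show ω ∈ A (N ω) ((N ω).filter (· ∈ ω))
      rw [h2, h1]; exact hA'
  have hdisj : (↑I : Set (Finset V × Finset V)).PairwiseDisjoint fun d => dataPiece N d.1 d.2 ∩ A d.1 d.2 := by
    intro d hd d' hd' hne
    have h1 : d.2 ⊆ d.1 := (Finset.mem_filter.1 (Finset.mem_coe.1 hd)).2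
    have h2 : d'.2 ⊆ d'.1 := (Finset.mem_filter.1 (Finset.mem_coe.1 hd')).2
    exact (disjoint_dataPiece h1 h2 (by rwa [Prod.mk.eta, Prod.mk.eta])).mono inter_subset_left inter_subset_left
  have hmeas : ∀ d ∈ I, MeasurableSet (dataPiece N d.1 d.2 ∩ A d.1 d.2) := fun d _ => by
    obtain ⟨H, -, hAH⟩ := hA d.1 d.2
    exact (determinedBy_dataPiece hN d.1 d.2).measurableSet_of_finset.inter hAH.measurableSet_of_finset
  rw [hcover, measureReal_biUnion_finset hdisj hmeas]
  refine Finset.sum_congr rfl fun d _ => ?_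
  obtain ⟨H, hFH, hAH⟩ := hA d.1 d.2
  rw [hμ, sitePercolation_real_inter_of_disjoint p (determinedBy_dataPiece hN d.1 d.2) hAH hFH]

open Classical in
/-- **Lower decoupling along a stopping set** (the use of "locally monotone" events given the
explored data, Nolin 2008, Lemma 12 [arXiv 0711.4948: Lemma 11], in summed form): if for every
data `(F, η)` the events `A F η` and `B F η` are determined by finite sets disjoint from `F` and
`P_p(B F η) ≥ c · P_p(A F η)`, then
`P_p({ω | ω ∈ B (data ω)}) ≥ c · P_p({ω | ω ∈ A (data ω)})`. (Typical use: `A` = fences present,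
`B` = fences present and extended by RSW paths in fresh regions, `c` = the RSW/Harris constant.) [cite: Nolin2008, §4.3 Lemma 12 and §4.5 proof of Prop. 17 (arXiv 0711.4948: Lemma 11, Prop. 16)] -/
theorem mul_real_mem_dataEvent_le (p : unitInterval) {G : Finset V} {N : Set V → Finset V}
    (hN : IsStoppingSet N) (hNG : ∀ ω, N ω ⊆ G) (A B : Finset V → Finset V → Set (SiteConfig V))
    (hA : ∀ F η, ∃ H : Finset V, Disjoint F H ∧ DeterminedBy (A F η) ↑H)
    (hB : ∀ F η, ∃ H : Finset V, Disjoint F H ∧ DeterminedBy (B F η) ↑H) {c : ℝ}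
    (hAB : ∀ F η, c * (sitePercolation V p).real (A F η) ≤ (sitePercolation V p).real (B F η)) :
    c * (sitePercolation V p).real {ω | ω ∈ A (N ω) ((N ω).filter (· ∈ ω))} ≤
      (sitePercolation V p).real {ω | ω ∈ B (N ω) ((N ω).filter (· ∈ ω))} := by
  rw [real_mem_dataEvent_eq p hN hNG A hA, real_mem_dataEvent_eq p hN hNG B hB, Finset.mul_sum]
  refine Finset.sum_le_sum fun d _ => ?_
  rw [mul_left_comm]
  exact mul_le_mul_of_nonneg_left (hAB d.1 d.2) measureReal_nonneg

end Literature.Probability.Percolation
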